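import Summits.AtomisticToContinuum.Crystallization.Theses.GappedShellCensus

/-!
# Crux `GappedShellCensus.TornFree` (stmt-AtomisticToContinuum-18069), line `Sketch` —
# the SPARSE-BOND SPLIT (lead c1, skeleton v3.4)

At unit scale with the torn bond based at the origin (finite ALLGAP configuration `Y ∋ 0`: every
pair of distinct points at distance `≥ 0.98` and `≤ 1.02` or `≥ 1.26`; at most twelve bonded
neighbours everywhere, exactly twelve within `3` of `0`): a bond `(0, v)` with at most two common
neighbours has at most one of them, or exactly two distinct ones.  So the sparse class of the
trichotomy (`tf_trichotomyUnit`, GappedShellCensusTornFreeTrichotomyUnit.lean) follows from the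
two finer class statements — the registered content stubs `stub_tfNoLonelyBondUnit` (`c ≤ 1`: two
twelve-coordinated sites suffice numerically, margin 1.5 % of the bond length) and
`stub_tfNoTwinBondUnit` (`c = 2`: misses two-centre feasibility by 8e-4 only) of skeleton v3.4
(Cruxes/TornFree/Lines/Sketch.lean) — taken here as hypotheses: `tf_sparseSplitUnit`.
Pure combinatorics (`Set.ncard_eq_two`); no definitions, no named facts.
-/

noncomputable section

namespace Summit.AtomisticToContinuum.Crystallization.Theorems

/-- **The sparse-bond split (skeleton v3.4 glue).** A bond with at most two commons has at most one
(`stub_tfNoLonelyBondUnit`) or exactly two distinct ones (`stub_tfNoTwinBondUnit`); the class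
statements are taken as hypotheses so that this glue lands independently of the content. -/
theorem tf_sparseSplitUnit :
    (∀ (Y : Set (EuclideanSpace ℝ (Fin 3))), Y.Finite → (0 : EuclideanSpace ℝ (Fin 3)) ∈ Y →
      (∀ p ∈ Y, ∀ q ∈ Y, p ≠ q → 1 - 1 / 50 ≤ dist p q ∧
        (dist p q ≤ 1 + 1 / 50 ∨ 63 / 50 ≤ dist p q)) →
      (∀ z ∈ Y, {w ∈ Y | w ≠ z ∧ dist z w ≤ 1 + 1 / 50}.ncard ≤ 12) →
      (∀ z ∈ Y, ‖z‖ ≤ 3 → {w ∈ Y | w ≠ z ∧ dist z w ≤ 1 + 1 / 50}.ncard = 12) →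
      ∀ v ∈ Y, v ≠ 0 → ‖v‖ ≤ 1 + 1 / 50 →
        {w ∈ Y | w ≠ 0 ∧ w ≠ v ∧ ‖w‖ ≤ 1 + 1 / 50 ∧ dist v w ≤ 1 + 1 / 50}.ncard ≤ 1 →
        False) →
    (∀ (Y : Set (EuclideanSpace ℝ (Fin 3))), Y.Finite → (0 : EuclideanSpace ℝ (Fin 3)) ∈ Y →
      (∀ p ∈ Y, ∀ q ∈ Y, p ≠ q → 1 - 1 / 50 ≤ dist p q ∧
        (dist p q ≤ 1 + 1 / 50 ∨ 63 / 50 ≤ dist p q)) →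
      (∀ z ∈ Y, {w ∈ Y | w ≠ z ∧ dist z w ≤ 1 + 1 / 50}.ncard ≤ 12) →
      (∀ z ∈ Y, ‖z‖ ≤ 3 → {w ∈ Y | w ≠ z ∧ dist z w ≤ 1 + 1 / 50}.ncard = 12) →
      ∀ v ∈ Y, v ≠ 0 → ‖v‖ ≤ 1 + 1 / 50 →
        {w ∈ Y | w ≠ 0 ∧ w ≠ v ∧ ‖w‖ ≤ 1 + 1 / 50 ∧ dist v w ≤ 1 + 1 / 50}.ncard ≤ 2 →
        ∀ w₁ ∈ Y, ∀ w₂ ∈ Y,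
          w₁ ≠ 0 → w₁ ≠ v → ‖w₁‖ ≤ 1 + 1 / 50 → dist v w₁ ≤ 1 + 1 / 50 →
          w₂ ≠ 0 → w₂ ≠ v → ‖w₂‖ ≤ 1 + 1 / 50 → dist v w₂ ≤ 1 + 1 / 50 →
          w₁ ≠ w₂ → False) →
    ∀ (Y : Set (EuclideanSpace ℝ (Fin 3))), Y.Finite → (0 : EuclideanSpace ℝ (Fin 3)) ∈ Y →
      (∀ p ∈ Y, ∀ q ∈ Y, p ≠ q → 1 - 1 / 50 ≤ dist p q ∧
        (dist p q ≤ 1 + 1 / 50 ∨ 63 / 50 ≤ dist p q)) →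
      (∀ z ∈ Y, {w ∈ Y | w ≠ z ∧ dist z w ≤ 1 + 1 / 50}.ncard ≤ 12) →
      (∀ z ∈ Y, ‖z‖ ≤ 3 → {w ∈ Y | w ≠ z ∧ dist z w ≤ 1 + 1 / 50}.ncard = 12) →
      ∀ v ∈ Y, v ≠ 0 → ‖v‖ ≤ 1 + 1 / 50 →
        {w ∈ Y | w ≠ 0 ∧ w ≠ v ∧ ‖w‖ ≤ 1 + 1 / 50 ∧ dist v w ≤ 1 + 1 / 50}.ncard ≤ 2 →
        False := by
  intro hLonely hTwin Y hfin h0 hgap hle htw v hv hv0 hdv h2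
  set C : Set (EuclideanSpace ℝ (Fin 3)) :=
    {w ∈ Y | w ≠ 0 ∧ w ≠ v ∧ ‖w‖ ≤ 1 + 1 / 50 ∧ dist v w ≤ 1 + 1 / 50} with hC
  rcases Nat.lt_or_ge C.ncard 2 with hlt | hge
  · have h1 : C.ncard ≤ 1 := by omega
    exact hLonely Y hfin h0 hgap hle htw v hv hv0 hdv h1
  · have hC2 : C.ncard = 2 := le_antisymm h2 hge
    obtain ⟨w₁, w₂, h12, hCeq⟩ := Set.ncard_eq_two.mp hC2
    have hw₁ : w₁ ∈ C := by rw [hCeq]; simp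
    have hw₂ : w₂ ∈ C := by rw [hCeq]; simp
    exact hTwin Y hfin h0 hgap hle htw v hv hv0 hdv h2 w₁ hw₁.1 w₂ hw₂.1
      hw₁.2.1 hw₁.2.2.1 hw₁.2.2.2.1 hw₁.2.2.2.2 hw₂.2.1 hw₂.2.2.1 hw₂.2.2.2.1 hw₂.2.2.2.2 h12

end Summit.AtomisticToContinuum.Crystallization.Theorems

end
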